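import Summits.Ventures.AbcSig.Rows.Bridge
import Summits.Ventures.AbcSig.Rows.C2aL251A45S
import Summits.Ventures.AbcSig.Rows.C2aL251A45SAB

/-!
# Venture AbcSig — CELL `C2aL251A45`: the census statement `Rows.C2aCellRed 251 (fun a => a = 4 ∨ a = 5) {11}` from the two row theorems

S-VARIANT (p-lean g6 `gen6/spatch.py`) of `cell_C2aL251A45`: kernel sieve discharges replace the cited pair(s) 2008.2 @ 13 (see the row file(s) `Rows/C2aL251A45S.lean`, `Rows/C2aL251A45SAB.lean`).
HONEST FRAMING. COMPUTATION cell `pub-abcsig`; CONDITIONAL theorem; no claim on ABC or any summit. Hypotheses exactly as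
in `Rows/C2aL251A45.lean` and `Rows/C2aL251A45AB.lean`: `BS04Package` (CITED), `DataComplete …` (COMPUTED level files), and the
rows' per-orbit exclusions for BOTH family predicates (`famB`, `famAB`) as universally quantified hypotheses (CITED: the census
row's certificates). Conclusion = p1's census predicate (`Rows/Statements.lean`), all four coprime coefficient
distributions `A·B = 2^a·251^m`, reduced exponents `a < n`, `m < n` (RULING H1). GENERATED by p-lean g2 gen/make_rows.py
(after plean/make_cell_bridges.py).
-/

namespace Summit.Ventures.AbcSig

/-- Cell `C2aL251A45`: `Rows.C2aCellRed 251 (fun a => a = 4 ∨ a = 5) {11}` under the rows' hypotheses. -/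
theorem xcell_C2aL251A45S (M : NewformModel) (hP : M.BS04Package)
    (hD502 : M.DataComplete 502 level502Orbits)
    (hD2008 : M.DataComplete 2008 level2008Orbits)
    (hRB_orbit_2008_2 : ∀ f : M.Form 2008, M.Matches f orbit_2008_2 → M.Matches f rb_2008_2) :
    Rows.C2aCellRed 251 (fun a => a = 4 ∨ a = 5) {11} :=
  C2aCellRed_of_rows 251 (by norm_num) (by norm_num) _ _
    (fun n hn h11 hnℓ hR a m ha han hm hmn x y z h1 h2 =>
      xrow_C2aL251A45S M hP hD502 hD2008 n hn h11 hnℓ (by simpa using hR) a m ha hm han hmn hRB_orbit_2008_2 x y z h1 h2)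
    (fun n hn h11 hnℓ hR a m ha han hm hmn x y z h1 h2 =>
      xrow_C2aL251A45SAB M hP hD502 hD2008 n hn h11 hnℓ (by simpa using hR) a m ha hm han hmn hRB_orbit_2008_2 x y z h1 h2)

end Summit.Ventures.AbcSig
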